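import Mathlib

/-!
# Length squeeze (algebraic core of LEMMA O of the solo-informed cell programme, s41)

LEMMA O (flat ⇒ ordinary at an unramified place for a locally split residual
representation `1 ⊕ ω`) argues as follows: for a flat deformation `W` (free of rank
two over an Artinian local ring `A`) the connected part `W⁰` is an `A`-submodule which is
*cyclic* (its reduction is the line `ω`) and has `A`-length equal to `length_A A`
(exactness of the connected–étale sequence along a composition series of `A`).
The purely algebraic conclusion — a cyclic module of full length is free of rank one —
is what this file kernel-checks, in three phrasings.

No number theory is formalised here; the statements are elementary consequences of the
strict monotonicity of `Module.length` on quotients (`Submodule.length_quotient_lt`).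
-/

namespace Summit.Langlands.Langlands.Theorems

open Function

variable {A : Type*} [CommRing A] [IsArtinian A A] [IsNoetherian A A]
variable {M : Type*} [AddCommGroup M] [Module A M]

/-- Length squeeze, surjective form: an `A`-linear surjection `A → M` onto a module whose
length equals the (finite) length of `A` is injective. -/
theorem lengthSqueeze_injective (f : A →ₗ[A] M) (hf : Surjective f)
    (h : Module.length A M = Module.length A A) : Injective f := by
  rw [← LinearMap.ker_eq_bot]
  by_contra hne
  have hlt := Submodule.length_quotient_lt (LinearMap.ker f) hne
  have heq : Module.length A (A ⧸ LinearMap.ker f) = Module.length A M :=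
    (f.quotKerEquivOfSurjective hf).length_eq
  rw [heq, h] at hlt
  exact lt_irrefl _ hlt

/-- Length squeeze, bijective form. -/
theorem lengthSqueeze_bijective (f : A →ₗ[A] M) (hf : Surjective f)
    (h : Module.length A M = Module.length A A) : Bijective f :=
  ⟨lengthSqueeze_injective f hf h, hf⟩

/-- Length squeeze, ideal form: a quotient `A ⧸ I` of the same length as `A` is the
trivial quotient. -/
theorem ideal_eq_bot_of_length_quotient_eq (I : Ideal A)
    (h : Module.length A (A ⧸ I) = Module.length A A) : I = ⊥ := by
  by_contra hne
  exact absurd h (Submodule.length_quotient_lt I hne).ne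

/-- Length squeeze, cyclic form (the shape used by LEMMA O): a cyclic `A`-module of full
length is free of rank one, i.e. `m ↦ a • m` is an isomorphism `A ≃ M`. -/
theorem lengthSqueeze_equiv_of_cyclic (m : M) (hm : Submodule.span A {m} = ⊤)
    (h : Module.length A M = Module.length A A) :
    Bijective (LinearMap.toSpanSingleton A M m) := by
  refine lengthSqueeze_bijective _ ?_ h
  rw [← LinearMap.range_eq_top, ← LinearMap.span_singleton_eq_range, hm]

/-- The resulting linear equivalence `A ≃ₗ[A] M` for a cyclic module of full length. -/
noncomputable def lengthSqueezeEquiv (m : M) (hm : Submodule.span A {m} = ⊤)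
    (h : Module.length A M = Module.length A A) : A ≃ₗ[A] M :=
  LinearEquiv.ofBijective (LinearMap.toSpanSingleton A M m)
    (lengthSqueeze_equiv_of_cyclic m hm h)

end Summit.Langlands.Langlands.Theorems
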